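import Literature.Computability.Complexity.NegacyclicFFT
import Literature.Computability.Complexity.StackFFTLevel
import HarnessLib

/-!
# Batch passes of the fast negacyclic multiplier: digitize, schoolbook base, item reversal

Literature / complexity toolkit, continuing `StackFFTLevel.lean` (roles `FReg`, the record
`FSlots` / `fSt`, block lists as items `encBlocks`, the level pass).  Further passes of the stack
machine that executes `negMulRec` of `NegacyclicFFT.lean` breadth-first over a batch of
instances (serving the machine of Harvey's factoring algorithm, `Cryptography/PQCWave0.lean`):

* the **digitize pass** `digitizePass` (**`runs_digitizePass`**): every block of `IN` (length
  `mt`) becomes its `t` zero-padded digits of length `2m` (`chunksPad m t = NegFFT.digits m t`,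
  `chunksPad_eq_digits`) on `OUT`, and one root twiddle `2m` per block goes onto `TWOUT`;
  pieces `digEntryMove` / `runs_digEntries` (entries of a block moved one by one as numeral
  items, unary count on the vector-pass register `U` carried in the base file: `fSt_update_v`),
  `runs_digZeros`, `digChunk` / **`runs_digChunk`**, `digBlock` / **`runs_digBlock`**;
* the **base pass** `basePass` (**`runs_basePass`**): the blocks of `IN` and `HOLD2` are paired
  and multiplied by the schoolbook negacyclic multiplier `negacyclicMul` of
  `StackNegacyclic.lean` (roles `rNF`, invariant `BaseInv`, `fSt_update_n`, `runs_baseBody`),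
  the products `negMul N L fᵢ gᵢ` landing on `OUT`;
* the **item-reverse pass** `revPass` (**`runs_revPass`**): `encBlocks Bs.reverse` onto `HOLD`
  (each block emitted reversed and poured, i.e. prepended as a forward item).

All costs are linear in the data size times `n` (plus the multiplier's `negMulCost`).

## References

* J. von zur Gathen, J. Gerhard, *Modern Computer Algebra*, 3rd ed., CUP 2013, §8.3 Alg. 8.20
  (steps 1 and 4: digitization and recursive products). (Folklore material, fully proved here.)
* D. Harvey, Math. Comp. 90 (2021), §2.2 [Harvey2021].
-/

namespace Literature.Computability.Complexity

open _root_.Computability SProg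

/-- Successive chunks of length `m`, each zero-padded to `2m`: the recursion the digitize pass
runs. [folklore] -/
def chunksPad (m : ℕ) : ℕ → List ℕ → List (List ℕ)
  | 0, _ => []
  | t + 1, b => (b.take m ++ List.replicate m 0) :: chunksPad m t (b.drop m)

/-- The chunks are the digits of `NegacyclicFFT.lean`. [folklore] -/
theorem chunksPad_eq_digits (m : ℕ) : ∀ (t : ℕ) (b : List ℕ), chunksPad m t b = NegFFT.digits m t b
  | 0, b => by simp [chunksPad, NegFFT.digits]
  | t + 1, b => by
    rw [chunksPad, chunksPad_eq_digits m t (b.drop m), NegFFT.digits, NegFFT.digits, List.range_succ_eq_map, List.map_cons,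
      List.map_map, zero_mul, List.drop_zero]
    congr 1
    refine List.map_congr_left fun j _ => ?_
    simp only [Function.comp_apply, List.drop_drop, Nat.succ_mul]
    rw [Nat.add_comm]

/-- Pushing numerals one by one onto a reversed accumulator of numerals. [folklore] -/
def pushNums : List ℕ → List Bool → List Bool
  | [], acc => acc
  | a :: as, acc => pushNums as (true :: false :: ((dbl (encodeNat a)).reverse ++ acc))

/-- `pushNums` onto a reversed accumulator of emitted numerals. [folklore] -/
theorem pushNums_outRev : ∀ (as E : List ℕ), pushNums as (Com.outRev (E.map encodeNat)) = Com.outRev ((E ++ as).map encodeNat)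
  | [], E => by simp [pushNums]
  | a :: as, E => by
    rw [pushNums, show true :: false :: ((dbl (encodeNat a)).reverse ++ Com.outRev (E.map encodeNat)) =
      Com.outRev ((E ++ [a]).map encodeNat) by rw [List.map_append, List.map_singleton, Com.outRev_append]; rfl,
      pushNums_outRev as (E ++ [a]), List.append_assoc, List.singleton_append]

namespace Com

variable {β : Type} [DecidableEq β] (q : FReg ↪ β)

/-! ### The digitize pass -/

/-- Move one entry of the block in `X2` onto the numeral accumulator `SACC` (through `X1`).
[folklore] -/
def digEntryMove : Com (EReg ⊕ β) :=
  readItemTo (Sum.inr (q .X2)) (Sum.inr (q .X1)) (vr (rVF q) .W) (vr (rVF q) .TT) ;; emit (Sum.inr (q .X1)) (Sum.inr (q .SACC))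

/-- Push an empty numeral (the entry `0`) onto `SACC` (`X1` empty). [folklore] -/
def digZero : Com (EReg ⊕ β) := emit (Sum.inr (q .X1)) (Sum.inr (q .SACC))

/-- One chunk: `m` entries of `X2` then `m` zeros onto `SACC`, poured as a block onto `X1` and
emitted as an item onto `OACC` (`m` in `HN`, unary counter `U`). [folklore] -/
def digChunk : Com (EReg ⊕ β) :=
  nToUnary (rVF q .U) (q .HN) ;; (countLoop (vr (rVF q) .U) (digEntryMove q) ;;
  (nToUnary (rVF q .U) (q .HN) ;; (countLoop (vr (rVF q) .U) (digZero q) ;;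
  (pour (Sum.inr (q .SACC)) (Sum.inr (q .X1)) ;; emit (Sum.inr (q .X1)) (Sum.inr (q .OACC))))))

/-- One block: read it into `X2`, emit the root twiddle `2m` (copied from `M2` via `X1`) onto `TWACC`,
then `t` chunks (`t` in `T1`, unary counter `CNT`). [folklore] -/
def digBlock : Com (EReg ⊕ β) :=
  readItemTo (Sum.inr (q .IN)) (Sum.inr (q .X2)) (vr (rVF q) .W) (vr (rVF q) .TT) ;;
  (copy (Sum.inr (q .M2)) (Sum.inr (q .X1)) (ra .t) (ra .u) ;; (emit (Sum.inr (q .X1)) (Sum.inr (q .TWACC)) ;;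
  (nToUnary (q .CNT) (q .T1) ;; countLoop (Sum.inr (q .CNT)) (digChunk q))))

/-- The digitize pass: every block of `IN` (length `mt`) becomes `t` blocks of length `2m` on
`OUT`, and one root twiddle `2m` per block goes onto `TWOUT`. [folklore] -/
def digitizePass : Com (EReg ⊕ β) :=
  streamLoop (Sum.inr (q .IN)) (vr (rVF q) .W) (digBlock q) ;;
  (pour (Sum.inr (q .OACC)) (Sum.inr (q .OUT)) ;; pour (Sum.inr (q .TWACC)) (Sum.inr (q .TWOUT)))

/-- Cost of one chunk of `m` entries at size bound `n`. [folklore] -/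
def digChunkCost (n m : ℕ) : ℕ := 75 * m * n + 42 * n + 19 * m + 16

/-- Cost of one block of `t` chunks. [folklore] -/
def digBlockCost (n m t : ℕ) : ℕ := t * (97 * m * n + 58 * n + 19 * m + 18) + 35 * n + 21

/-- Cost of the digitize pass over `B` blocks. [folklore] -/
def digitizeCost (n m t B : ℕ) : ℕ := B * (digBlockCost n m t + 24 * t * m * n + 6 * t + 6 * n + 6) + 6

/-- Updating a non-slot vector-pass register commutes with `fSt`. [folklore] -/
theorem fSt_update_v (T : Regs β) (z : FSlots) {x : VReg} (hE : x ≠ .E) (hL1 : x ≠ .L1) (hL2 : x ≠ .L2) (hDST : x ≠ .DST)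
    (v : List Bool) : fSt q (Function.update T (q (.n (.v x))) v) z = Function.update (fSt q T z) (q (.n (.v x))) v := by
  have hq : ∀ {i j : FReg}, i ≠ j → q i ≠ q j := fun h => q.injective.ne h
  funext y
  by_cases hy : y = q (.n (.v x))
  · subst hy
    rw [Function.update_self, fSt_v q _ z hE hL1 hL2 hDST, Function.update_self]
  · rw [Function.update_of_ne hy]
    simp only [fSt, Function.update_apply, hy, if_false]

/-- Moving the first `|c|` entries of `X2 = encVec (c ++ rest)` onto `SACC` (unary count on `U`,
carried in the base file): `X2 := encVec rest`, the entries pushed in order, `U` emptied.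
[folklore] -/
theorem runs_digEntries {N n : ℕ} (hn : (encodeNat N).length + 1 ≤ n) (T : Regs β)
    (hW : T (q (.n (.v .W))) = []) (hTT : T (q (.n (.v .TT))) = []) (hU : T (q (.n (.v .U))) = [])
    (z : FSlots) {c rest : List ℕ} (hc : ∀ a ∈ c, a < N) (hzx2 : z.x2 = encVec (c ++ rest)) (hzx1 : z.x1 = []) :
    Runs (countLoop (vr (rVF q) .U) (digEntryMove q))
      (base (fSt q (Function.update T (q (.n (.v .U))) (List.replicate c.length true)) z))
      (base (fSt q T { z with x2 := encVec rest, sacc := pushNums c z.sacc })) (c.length * (15 * n + 14) + 1) := by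
  have hq : ∀ {i j : FReg}, i ≠ j → q i ≠ q j := fun h => q.injective.ne h
  let Tk : ℕ → Regs β := fun k => Function.update T (q (.n (.v .U))) (List.replicate k true)
  have rdU : ∀ k (zz : FSlots), fSt q (Tk k) zz (q (.n (.v .U))) = List.replicate k true := fun k zz => by
    rw [fSt_v q _ _ (by decide) (by decide) (by decide) (by decide)]; simp [Tk]
  have hT0 : Function.update T (q (.n (.v .U))) ([] : List Bool) = T := Function.update_eq_self_iff.2 hU.symm
  have hTkW : ∀ k, Tk k (q (.n (.v .W))) = [] := fun k => by simp [Tk, hW]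
  have hTkTT : ∀ k, Tk k (q (.n (.v .TT))) = [] := fun k => by simp [Tk, hTT]
  let st : ℕ → List ℕ → List Bool → Regs (EReg ⊕ β) := fun k c' sa => base (fSt q (Tk k) { z with x2 := encVec (c' ++ rest), sacc := sa })
  have hstU : ∀ k k' c' sa, Function.update (st k c' sa) (vr (rVF q) .U) (List.replicate k' true) = st k' c' sa := by
    intro k k' c' sa
    simp only [st, vr, Function.Embedding.trans_apply, NReg.ιV_apply, FReg.ιN_apply, update_nst_inr, Tk,
      fSt_update_v q _ _ (show VReg.U ≠ .E by decide) (by decide) (by decide) (by decide), Function.update_idem]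
  have h := runs_countLoop (U := vr (rVF q) .U) (body := digEntryMove q)
    (fun k R => ∃ c' sa, c'.length = k ∧ (∀ a ∈ c', a ∈ c) ∧ pushNums c' sa = pushNums c z.sacc ∧ R = st k c' sa) (15 * n + 12)
    (by
      rintro k R ⟨c', sa, hk, hsub, hpush, rfl⟩ -
      obtain ⟨a, c'', rfl⟩ : ∃ a t, c' = a :: t := by
        cases c' with
        | nil => simp at hk
        | cons a t => exact ⟨a, t, rfl⟩
      simp only [List.length_cons, Nat.add_right_cancel_iff] at hk
      have ha : a < N := hc a (hsub a (by simp))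
      have hla : (encodeNat a).length ≤ n - 1 := (length_encodeNat_le_of_lt_nat ha).trans (by omega)
      rw [hstU]
      let z1 : FSlots := { z with x2 := encVec (c'' ++ rest), sacc := sa, x1 := encodeNat a }
      have h1 : Runs (readItemTo (Sum.inr (q .X2)) (Sum.inr (q .X1)) (vr (rVF q) .W) (vr (rVF q) .TT)) (st k (a :: c'') sa)
          (base (fSt q (Tk k) z1)) (11 * n + 9) := by
        refine (runs_readItemTo (by simp [hq]) (by simp [hq]) (by simp [hq]) (by simp [hq]) (by simp [hq]) (encodeNat a) (encVec (c'' ++ rest))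
          (st k (a :: c'') sa) (by simp [st, encVec_cons]) (by simp [st, fSt_v, hTkW]) (by simp [st, fSt_v, hTkTT])).of_eq
          (by simp [st, z1, hzx1]) ?_
        omega
      have h2 : Runs (emit (Sum.inr (q .X1)) (Sum.inr (q .SACC))) (base (fSt q (Tk k) z1))
          (st k c'' (true :: false :: ((dbl (encodeNat a)).reverse ++ sa))) (4 * n + 3) := by
        refine (runs_emit (h := Sum.inr (q .X1)) (o := Sum.inr (q .SACC)) (by simp [hq]) _).of_eq ?_ ?_
        · simp [st, z1, hzx1, dbl]
        · simp only [nst_inr, fSt_X1, z1]; omega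
      refine ⟨st k c'' (true :: false :: ((dbl (encodeNat a)).reverse ++ sa)), (h1.seq h2).of_eq rfl (by omega), by simp [st, rdU],
        c'', _, hk, fun x hx => hsub x (by simp [hx]), by rw [← hpush, pushNums], rfl⟩)
    c.length (st c.length c z.sacc) ⟨c, z.sacc, rfl, fun _ h => h, rfl, rfl⟩ (by simp [st, rdU])
  obtain ⟨R', hR, -, c', sa, hk, -, hpush, rfl⟩ := h
  obtain rfl : c' = [] := List.eq_nil_of_length_eq_zero hk
  rw [pushNums] at hpush
  have e0 : st c.length c z.sacc = base (fSt q (Function.update T (q (.n (.v .U))) (List.replicate c.length true)) z) := by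
    simp only [st, Tk, ← hzx2]
  rw [e0] at hR
  refine hR.of_eq ?_ le_rfl
  simp only [st, Tk, List.nil_append, List.replicate_zero, hpush, hT0]

/-- Pushing `k` zero entries (empty numerals) onto `SACC` (unary count on `U` in the base file).
[folklore] -/
theorem runs_digZeros (T : Regs β) (hU : T (q (.n (.v .U))) = []) (z : FSlots) (hzx1 : z.x1 = []) (k : ℕ) :
    Runs (countLoop (vr (rVF q) .U) (digZero q))
      (base (fSt q (Function.update T (q (.n (.v .U))) (List.replicate k true)) z))
      (base (fSt q T { z with sacc := pushNums (List.replicate k 0) z.sacc })) (k * 5 + 1) := by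
  have hq : ∀ {i j : FReg}, i ≠ j → q i ≠ q j := fun h => q.injective.ne h
  let Tk : ℕ → Regs β := fun k => Function.update T (q (.n (.v .U))) (List.replicate k true)
  have rdU : ∀ k (zz : FSlots), fSt q (Tk k) zz (q (.n (.v .U))) = List.replicate k true := fun k zz => by
    rw [fSt_v q _ _ (by decide) (by decide) (by decide) (by decide)]; simp [Tk]
  have hT0 : Function.update T (q (.n (.v .U))) ([] : List Bool) = T := Function.update_eq_self_iff.2 hU.symm
  let st : ℕ → List Bool → Regs (EReg ⊕ β) := fun k sa => base (fSt q (Tk k) { z with sacc := sa })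
  have hstU : ∀ k k' sa, Function.update (st k sa) (vr (rVF q) .U) (List.replicate k' true) = st k' sa := by
    intro k k' sa
    simp only [st, vr, Function.Embedding.trans_apply, NReg.ιV_apply, FReg.ιN_apply, update_nst_inr, Tk,
      fSt_update_v q _ _ (show VReg.U ≠ .E by decide) (by decide) (by decide) (by decide), Function.update_idem]
  have h := runs_countLoop (U := vr (rVF q) .U) (body := digZero q)
    (fun j R => ∃ sa, pushNums (List.replicate j 0) sa = pushNums (List.replicate k 0) z.sacc ∧ R = st j sa) 3
    (by
      rintro j R ⟨sa, hpush, rfl⟩ -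
      rw [hstU]
      refine ⟨st j (true :: false :: sa), (runs_emit (h := Sum.inr (q .X1)) (o := Sum.inr (q .SACC)) (by simp [hq]) _).of_eq ?_ ?_,
        by simp [st, rdU], (true :: false :: sa), ?_, rfl⟩
      · simp [st, hzx1]
      · simp [st, hzx1]
      · rw [← hpush, List.replicate_succ, pushNums]; rfl)
    k (st k z.sacc) ⟨z.sacc, rfl, rfl⟩ (by simp [st, rdU])
  obtain ⟨R', hR, -, sa, hpush, rfl⟩ := h
  rw [List.replicate_zero, pushNums] at hpush
  refine hR.of_eq ?_ (by omega)
  simp only [st, Tk, List.replicate_zero, hpush, hT0]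

/-- A zero-padded chunk of a list with entries `< N` is a valid block. [folklore] -/
theorem chunk_valid {N m : ℕ} {c : List ℕ} (hc : ∀ a ∈ c, a < N) (hl : c.length = m) :
    (c ++ List.replicate m 0).length = 2 * m ∧ ∀ a ∈ c ++ List.replicate m 0, a < N := by
  have hN : 0 < m → 0 < N := fun hm => by
    obtain ⟨a, t, rfl⟩ : ∃ a t, c = a :: t := by
      cases c with
      | nil => simp at hl; omega
      | cons a t => exact ⟨a, t, rfl⟩
    exact (Nat.zero_le a).trans_lt (hc a (by simp))
  refine ⟨by rw [List.length_append, List.length_replicate, hl]; ring, fun a ha => ?_⟩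
  rw [List.mem_append, List.mem_replicate] at ha
  rcases ha with ha | ⟨hm, rfl⟩
  · exact hc a ha
  · exact hN (Nat.pos_of_ne_zero hm)

/-- **One chunk.** With `HN = encodeNat m`, `X2 = encVec (c ++ rest)` (`|c| = m`), `X1`, `SACC`,
`U` empty: `X2 := encVec rest` and the block `c ++ 0^m` is emitted onto `OACC`. [folklore] -/
theorem runs_digChunk {N n m : ℕ} (hn : (encodeNat N).length + 1 ≤ n) (hmn : (encodeNat m).length ≤ n) (T : Regs β)
    (hHN : T (q .HN) = encodeNat m) (hW : T (q (.n (.v .W))) = []) (hTT : T (q (.n (.v .TT))) = []) (hU : T (q (.n (.v .U))) = [])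
    (z : FSlots) {c rest : List ℕ} (hc : ∀ a ∈ c, a < N) (hl : c.length = m) (hzx2 : z.x2 = encVec (c ++ rest))
    (hzx1 : z.x1 = []) (hzs : z.sacc = []) :
    Runs (digChunk q) (base (fSt q T z))
      (base (fSt q T { z with x2 := encVec rest, oacc := pushItem (c ++ List.replicate m 0) z.oacc })) (digChunkCost n m) := by
  have hq : ∀ {i j : FReg}, i ≠ j → q i ≠ q j := fun h => q.injective.ne h
  have hcv := chunk_valid hc hl
  have hlc := length_encVec_block hcv hn
  have hsacc : pushNums (List.replicate m 0) (pushNums c []) = (encVec (c ++ List.replicate m 0)).reverse := by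
    have h1 := pushNums_outRev c []
    rw [List.map_nil, outRev_nil, List.nil_append] at h1
    rw [h1, pushNums_outRev, ← reverse_outRev_map, List.reverse_reverse]
  have hU' : ∀ zz : FSlots, fSt q T zz (rVF q .U) = [] := fun zz => by
    simp only [rVF, Function.Embedding.trans_apply, NReg.ιV_apply, FReg.ιN_apply]
    rw [fSt_v q _ _ (by decide) (by decide) (by decide) (by decide)]; exact hU
  have hTo : ∀ (zz : FSlots) (k : ℕ), Function.update (fSt q T zz) (rVF q .U) (List.replicate k true) =
      fSt q (Function.update T (q (.n (.v .U))) (List.replicate k true)) zz := fun zz k => by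
    simp only [rVF, Function.Embedding.trans_apply, NReg.ιV_apply, FReg.ιN_apply]
    rw [fSt_update_v q _ _ (by decide) (by decide) (by decide) (by decide)]
  let z1 : FSlots := { z with x2 := encVec rest, sacc := pushNums c [] }
  let z2 : FSlots := { z with x2 := encVec rest, sacc := (encVec (c ++ List.replicate m 0)).reverse }
  let z3 : FSlots := { z with x2 := encVec rest, sacc := [], x1 := encVec (c ++ List.replicate m 0) }
  let z4 : FSlots := { z with x2 := encVec rest, sacc := [], x1 := [], oacc := pushItem (c ++ List.replicate m 0) z.oacc }
  have h1 : Runs (nToUnary (rVF q .U) (q .HN)) (base (fSt q T z))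
      (base (fSt q (Function.update T (q (.n (.v .U))) (List.replicate c.length true)) z)) (n * (16 * m + 21) + 5) := by
    refine (runs_nToUnary (rVF q .U) (q .HN) (fSt q T z) (hU' z)).of_eq (by rw [fSt_HN, hHN, bitsToNat_encodeNat, hl, hTo]) ?_
    simp only [fSt_HN, hHN, bitsToNat_encodeNat]
    exact Nat.add_le_add_right (Nat.mul_le_mul_right _ hmn) _
  have h2 : Runs (countLoop (vr (rVF q) .U) (digEntryMove q)) (base (fSt q (Function.update T (q (.n (.v .U))) (List.replicate c.length true)) z))
      (base (fSt q T z1)) (c.length * (15 * n + 14) + 1) :=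
    (runs_digEntries q hn T hW hTT hU z hc hzx2 hzx1).of_eq (by simp [z1, hzs]) le_rfl
  have h3 : Runs (nToUnary (rVF q .U) (q .HN)) (base (fSt q T z1))
      (base (fSt q (Function.update T (q (.n (.v .U))) (List.replicate m true)) z1)) (n * (16 * m + 21) + 5) := by
    refine (runs_nToUnary (rVF q .U) (q .HN) (fSt q T z1) (hU' z1)).of_eq (by rw [fSt_HN, hHN, bitsToNat_encodeNat, hTo]) ?_
    simp only [fSt_HN, hHN, bitsToNat_encodeNat]
    exact Nat.add_le_add_right (Nat.mul_le_mul_right _ hmn) _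
  have h4 : Runs (countLoop (vr (rVF q) .U) (digZero q)) (base (fSt q (Function.update T (q (.n (.v .U))) (List.replicate m true)) z1))
      (base (fSt q T z2)) (m * 5 + 1) :=
    (runs_digZeros q T hU z1 (by simp [z1, hzx1]) m).of_eq (by simp [z1, z2, hsacc]) le_rfl
  have h5 : Runs (pour (Sum.inr (q .SACC)) (Sum.inr (q .X1))) (base (fSt q T z2)) (base (fSt q T z3)) (3 * (2 * m * (2 * n)) + 1) := by
    refine (runs_opour (a := q .SACC) (b := q .X1) (hq (by decide)) (fSt q T z2)).of_eq ?_ ?_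
    · simp [z2, z3, hzx1]
    · simp only [fSt_SACC, z2, List.length_reverse]; omega
  have h6 : Runs (emit (Sum.inr (q .X1)) (Sum.inr (q .OACC))) (base (fSt q T z3)) (base (fSt q T z4)) (4 * (2 * m * (2 * n)) + 3) := by
    refine (runs_emit (h := Sum.inr (q .X1)) (o := Sum.inr (q .OACC)) (by simp [hq]) _).of_eq ?_ ?_
    · simp [z3, z4, pushItem, dbl]
    · simp only [nst_inr, fSt_X1, z3]; omega
  refine (h1.seq (h2.seq (h3.seq (h4.seq (h5.seq h6))))).of_eq (by simp only [z4, hzs, hzx1]) ?_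
  rw [hl]; unfold digChunkCost; nlinarith [Nat.zero_le (m * n)]

/-- **One block.** With `IN = encBlocks (b :: bs)` (`|b| = mt`, entries `< N`), `T1 = encodeNat t`,
`HN = encodeNat m`, `M2 = encodeNat (2m)`, and `X1 X2 SACC CNT U` empty: `IN := encBlocks bs`, the
root twiddle `2m` is pushed onto `TWACC` and the `t` zero-padded chunks onto `OACC`. [folklore] -/
theorem runs_digBlock {N n m t : ℕ} (hn : (encodeNat N).length + 1 ≤ n) (hmn : (encodeNat m).length ≤ n)
    (hm2n : (encodeNat (2 * m)).length ≤ n) (htn : (encodeNat t).length ≤ n) (T : Regs β)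
    (hHN : T (q .HN) = encodeNat m) (hM2 : T (q .M2) = encodeNat (2 * m)) (hW : T (q (.n (.v .W))) = [])
    (hTT : T (q (.n (.v .TT))) = []) (hU : T (q (.n (.v .U))) = [])
    (z : FSlots) {b : List ℕ} {bs : List (List ℕ)} (hb : ∀ a ∈ b, a < N) (hlb : b.length = m * t)
    (hzin : z.inp = encBlocks (b :: bs)) (hzt1 : z.t1 = encodeNat t) (hzx1 : z.x1 = []) (hzx2 : z.x2 = []) (hzs : z.sacc = [])
    (hzc : z.cnt = []) :
    Runs (digBlock q) (base (fSt q T z))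
      (base (fSt q T { z with inp := encBlocks bs, twacc := pushNums [2 * m] z.twacc, oacc := pushBlocks (chunksPad m t b) z.oacc }))
      (digBlockCost n m t) := by
  have hq : ∀ {i j : FReg}, i ≠ j → q i ≠ q j := fun h => q.injective.ne h
  have rdW : ∀ zz : FSlots, fSt q T zz (q (.n (.v .W))) = [] := fun zz => by rw [fSt_v q T zz] <;> first | decide | exact hW
  have rdTT : ∀ zz : FSlots, fSt q T zz (q (.n (.v .TT))) = [] := fun zz => by rw [fSt_v q T zz] <;> first | decide | exact hTT
  have hlb' : (encVec b).length ≤ m * t * (2 * n) := by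
    have := length_encVec_le_of_lt hb hn; rwa [hlb] at this
  let z1 : FSlots := { z with inp := encBlocks bs, x2 := encVec b }
  let z2 : FSlots := { z with inp := encBlocks bs, x2 := encVec b, x1 := encodeNat (2 * m) }
  let z3 : FSlots := { z with inp := encBlocks bs, x2 := encVec b, x1 := [], twacc := pushNums [2 * m] z.twacc }
  let z4 : FSlots := { z with inp := encBlocks bs, x2 := encVec b, x1 := [], twacc := pushNums [2 * m] z.twacc, cnt := List.replicate t true }
  let z5 : FSlots := { z with inp := encBlocks bs, x2 := [], x1 := [], twacc := pushNums [2 * m] z.twacc, cnt := [], oacc := pushBlocks (chunksPad m t b) z.oacc }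
  have h1 : Runs (readItemTo (Sum.inr (q .IN)) (Sum.inr (q .X2)) (vr (rVF q) .W) (vr (rVF q) .TT)) (base (fSt q T z))
      (base (fSt q T z1)) (11 * (m * t * (2 * n)) + 9) := by
    refine (runs_readItemTo (by simp [hq]) (by simp [hq]) (by simp [hq]) (by simp [hq]) (by simp [hq]) (encVec b) (encBlocks bs)
      (base (fSt q T z)) (by simp [hzin, encBlocks_cons]) (by simp [rdW]) (by simp [rdTT])).of_eq (by simp [z1, hzx2]) ?_
    omega
  have h2 : Runs (copy (Sum.inr (q .M2)) (Sum.inr (q .X1)) (ra .t) (ra .u)) (base (fSt q T z1)) (base (fSt q T z2)) (10 * n + 3) := by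
    refine (runs_ocopy (a := q .M2) (b := q .X1) (hq (by decide)) (fSt q T z1)).of_eq (by simp [z1, z2, hM2, hzx1]) ?_
    simp only [fSt_M2, hM2]; omega
  have h3 : Runs (emit (Sum.inr (q .X1)) (Sum.inr (q .TWACC))) (base (fSt q T z2)) (base (fSt q T z3)) (4 * n + 3) := by
    refine (runs_emit (h := Sum.inr (q .X1)) (o := Sum.inr (q .TWACC)) (by simp [hq]) _).of_eq ?_ ?_
    · simp [z2, z3, pushNums, dbl]
    · simp only [nst_inr, fSt_X1, z2]; omega
  have h4 : Runs (nToUnary (q .CNT) (q .T1)) (base (fSt q T z3)) (base (fSt q T z4)) (n * (16 * t + 21) + 5) := by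
    refine (runs_nToUnary (q .CNT) (q .T1) (fSt q T z3) (by simp [z3, hzc])).of_eq (by simp [z3, z4, hzt1]) ?_
    simp only [fSt_T1, z3, hzt1, bitsToNat_encodeNat]
    exact Nat.add_le_add_right (Nat.mul_le_mul_right _ htn) _
  -- the chunk loop
  have h5 : Runs (countLoop (Sum.inr (q .CNT)) (digChunk q)) (base (fSt q T z4)) (base (fSt q T z5)) (t * (digChunkCost n m + 2) + 1) := by
    let st : ℕ → List ℕ → List Bool → Regs β := fun k r o =>
      fSt q T { z with inp := encBlocks bs, x2 := encVec r, x1 := [], twacc := pushNums [2 * m] z.twacc, cnt := List.replicate k true, oacc := o }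
    have h := runs_countLoop (U := Sum.inr (q .CNT)) (body := digChunk q)
      (fun k R => ∃ r o, r.length = m * k ∧ (∀ a ∈ r, a ∈ b) ∧ pushBlocks (chunksPad m k r) o = pushBlocks (chunksPad m t b) z.oacc ∧
        R = base (st k r o)) (digChunkCost n m)
      (by
        rintro k R ⟨r, o, hlr, hsub, hpush, rfl⟩ -
        have e1 : Function.update (base (st (k + 1) r o)) (Sum.inr (q .CNT)) (List.replicate k true) = base (st k r o) := by simp [st]
        rw [e1]
        have hlt : (r.take m).length = m := by rw [List.length_take, hlr]; exact min_eq_left (by nlinarith)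
        have hb' := runs_digChunk q hn hmn T hHN hW hTT hU
          { z with inp := encBlocks bs, x2 := encVec r, x1 := [], twacc := pushNums [2 * m] z.twacc, cnt := List.replicate k true, oacc := o }
          (c := r.take m) (rest := r.drop m) (fun a ha => hb a (hsub a (List.mem_of_mem_take ha))) hlt
          (by simp [List.take_append_drop]) rfl (by simp [hzs])
        refine ⟨base (st k (r.drop m) (pushItem (r.take m ++ List.replicate m 0) o)), hb'.of_eq rfl le_rfl, by simp [st],
          r.drop m, _, by rw [List.length_drop, hlr, Nat.mul_succ]; omega, fun a ha => hsub a (List.mem_of_mem_drop ha), ?_, rfl⟩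
        rw [← hpush, chunksPad, pushBlocks])
      t (base (st t b z.oacc)) ⟨b, z.oacc, hlb, fun _ h => h, rfl, rfl⟩ (by simp [st])
    obtain ⟨R', hR, -, r, o, hlr, -, hpush, rfl⟩ := h
    rw [Nat.mul_zero, List.length_eq_zero_iff] at hlr
    subst hlr
    rw [chunksPad, pushBlocks] at hpush
    refine hR.of_eq ?_ le_rfl
    simp only [st, z5, encVec_nil, List.replicate_zero, hpush]
  refine (h1.seq (h2.seq (h3.seq (h4.seq h5)))).of_eq (by simp only [z5, hzx2, hzx1, hzc]) ?_
  unfold digBlockCost digChunkCost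
  nlinarith [Nat.zero_le (m * t * n), Nat.zero_le (t * n), Nat.zero_le (m * n)]

/-- `pushBlocks` of a concatenation. [folklore] -/
theorem _root_.Literature.Computability.Complexity.pushBlocks_append :
    ∀ (A B : List (List ℕ)) (acc : List Bool), pushBlocks (A ++ B) acc = pushBlocks B (pushBlocks A acc)
  | [], _, _ => rfl
  | a :: A, B, acc => by rw [List.cons_append, pushBlocks, pushBlocks, pushBlocks_append A B]

/-- `chunksPad` yields `t` valid blocks of length `2m`. [folklore] -/
theorem _root_.Literature.Computability.Complexity.chunksPad_valid {N : ℕ} (m : ℕ) :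
    ∀ (t : ℕ) (b : List ℕ), (∀ a ∈ b, a < N) → b.length = m * t →
      (chunksPad m t b).length = t ∧ ∀ c ∈ chunksPad m t b, c.length = 2 * m ∧ ∀ a ∈ c, a < N
  | 0, _, _, _ => ⟨rfl, fun c hc => by simp [chunksPad] at hc⟩
  | t + 1, b, hb, hl => by
    have ih := chunksPad_valid m t (b.drop m) (fun a ha => hb a (List.mem_of_mem_drop ha)) (by rw [List.length_drop, hl, Nat.mul_succ]; omega)
    refine ⟨by rw [chunksPad, List.length_cons, ih.1], fun c hc => ?_⟩
    rw [chunksPad, List.mem_cons] at hc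
    rcases hc with rfl | hc
    · exact Com.chunk_valid (fun a ha => hb a (List.mem_of_mem_take ha)) (by rw [List.length_take, hl]; exact min_eq_left (by nlinarith))
    · exact ih.2 c hc

/-- **The digitize pass.** With `B` blocks of length `mt` (entries `< N`) in `IN`, `t` in `T1`,
`m` in `HN`, `2m` in `M2` and the working registers clean, the pass empties `IN` and puts
`encBlocks (Bs.flatMap (chunksPad m t))` on top of `OUT` and `encVec (replicate B (2m))` on top
of `TWOUT`. [folklore] -/
theorem runs_digitizePass {N n m t : ℕ} (hn : (encodeNat N).length + 1 ≤ n) (hmn : (encodeNat m).length ≤ n)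
    (hm2n : (encodeNat (2 * m)).length + 1 ≤ n) (htn : (encodeNat t).length ≤ n) (T : Regs β)
    (hHN : T (q .HN) = encodeNat m) (hM2 : T (q .M2) = encodeNat (2 * m)) (hW : T (q (.n (.v .W))) = [])
    (hTT : T (q (.n (.v .TT))) = []) (hU : T (q (.n (.v .U))) = [])
    {Bs : List (List ℕ)} (hBs : ∀ b ∈ Bs, (∀ a ∈ b, a < N) ∧ b.length = m * t)
    (hold hold2 tmp tw e l1 l2 dst : List Bool) :
    Runs (digitizePass q) (base (fSt q T ⟨encBlocks Bs, hold, hold2, tmp, tw, [], encodeNat t, [], [], [], [], [], e, l1, l2, dst⟩))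
      (base (Function.update (Function.update (fSt q T ⟨[], hold, hold2, tmp, tw, [], encodeNat t, [], [], [], [], [], e, l1, l2, dst⟩) (q .OUT)
        (encBlocks (Bs.flatMap (chunksPad m t)) ++ T (q .OUT))) (q .TWOUT) (encVec (List.replicate Bs.length (2 * m)) ++ T (q .TWOUT))))
      (digitizeCost n m t Bs.length) := by
  have hq : ∀ {i j : FReg}, i ≠ j → q i ≠ q j := fun h => q.injective.ne h
  let zOf : List (List ℕ) → List (List ℕ) → FSlots := fun done l =>
    ⟨encBlocks l, hold, hold2, tmp, tw, outRev ((List.replicate done.length (2 * m)).map encodeNat), encodeNat t, [], [], [],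
      outRev ((done.flatMap (chunksPad m t)).map encVec), [], e, l1, l2, dst⟩
  have hloop := runs_streamLoop (L := Sum.inr (q .IN)) (w := vr (rVF q) .W) (by simp [hq]) (body := digBlock q)
    encBlocks encBlocks_nil (fun a l => encList_cons_ne_nil (encVec a) (l.map encVec))
    (fun l R => ∃ done, done ++ l = Bs ∧ R = base (fSt q T (zOf done l))) (fun _ => digBlockCost n m t)
    (by
      rintro b l R ⟨done, hdl, rfl⟩ - -
      have hbmem : b ∈ Bs := by rw [← hdl]; simp
      obtain ⟨hb, hlb⟩ := hBs b hbmem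
      have hB := runs_digBlock q hn hmn (by omega) htn T hHN hM2 hW hTT hU (zOf done (b :: l)) (b := b) (bs := l) hb hlb
        rfl rfl rfl rfl rfl rfl
      have heq : base (fSt q T { zOf done (b :: l) with inp := encBlocks l, twacc := pushNums [2 * m] (zOf done (b :: l)).twacc, oacc := pushBlocks (chunksPad m t b) (zOf done (b :: l)).oacc }) = base (fSt q T (zOf (done ++ [b]) l)) := by
        simp only [zOf, List.length_append, List.length_singleton, List.flatMap_append, List.flatMap_cons, List.flatMap_nil,
          List.append_nil, pushBlocks_outRev, List.replicate_succ', pushNums_outRev]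
      refine ⟨_, hB.of_eq heq le_rfl, by simp [zOf], ?_, done ++ [b], by rw [List.append_assoc]; exact hdl, rfl⟩
      exact (fSt_v q T _ (by decide) (by decide) (by decide) (by decide)).trans hW)
    Bs (base (fSt q T (zOf [] Bs))) ⟨[], rfl, rfl⟩ (by simp [zOf])
    ((fSt_v q T _ (by decide) (by decide) (by decide) (by decide)).trans hW)
  obtain ⟨R', hl, -, -, done, hdone, rfl⟩ := hloop
  rw [List.append_nil] at hdone
  subst hdone
  have hstart : zOf [] done = ⟨encBlocks done, hold, hold2, tmp, tw, [], encodeNat t, [], [], [], [], [], e, l1, l2, dst⟩ := by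
    simp only [zOf, List.length_nil, List.replicate_zero, List.map_nil, outRev_nil, List.flatMap_nil]
  rw [hstart] at hl
  set out := done.flatMap (chunksPad m t) with hout
  set tw' := List.replicate done.length (2 * m) with htw'
  have hend : zOf done [] = ⟨[], hold, hold2, tmp, tw, outRev (tw'.map encodeNat), encodeNat t, [], [], [], outRev (out.map encVec), [], e, l1, l2, dst⟩ := by
    simp only [zOf, encBlocks_nil, htw', hout]
  rw [hend] at hl
  -- lengths
  have hov : ∀ c ∈ out, c.length = 2 * m ∧ ∀ a ∈ c, a < N := by
    intro c hc
    rw [hout, List.mem_flatMap] at hc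
    obtain ⟨b, hb, hc⟩ := hc
    exact (chunksPad_valid m t b (hBs b hb).1 (hBs b hb).2).2 c hc
  have hlout : out.length = done.length * t := by
    rw [hout, List.length_flatMap]
    have : ∀ b ∈ done, (chunksPad m t b).length = t := fun b hb => (chunksPad_valid m t b (hBs b hb).1 (hBs b hb).2).1
    rw [List.map_congr_left this, List.map_const', List.sum_replicate, smul_eq_mul]
  have hlo : (outRev (out.map encVec)).length ≤ done.length * t * (2 * (2 * m * (2 * n)) + 2) := by
    rw [← reverse_encBlocks, List.length_reverse]
    have := length_encBlocks_le (m := m) hn hov; rwa [hlout] at this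
  have hltw : (outRev (tw'.map encodeNat)).length ≤ done.length * (2 * n) := by
    rw [← List.length_reverse, reverse_outRev_map, htw',
      show encVec (List.replicate done.length (2 * m)) = encList ((List.replicate done.length (2 * m)).map encodeNat) from rfl,
      length_encList, List.map_replicate, List.map_replicate, List.sum_replicate, smul_eq_mul]
    exact Nat.mul_le_mul_left _ (by omega)
  -- the two pours, explicitly (as in `runs_levelPass`)
  set B0 : Regs β := fSt q T ⟨[], hold, hold2, tmp, tw, [], encodeNat t, [], [], [], [], [], e, l1, l2, dst⟩ with hB0
  have hS1 : fSt q T ⟨[], hold, hold2, tmp, tw, outRev (tw'.map encodeNat), encodeNat t, [], [], [], outRev (out.map encVec), [], e, l1, l2, dst⟩ =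
      Function.update (Function.update B0 (q .OACC) (outRev (out.map encVec))) (q .TWACC) (outRev (tw'.map encodeNat)) := by
    rw [hB0, update_fSt_OACC, update_fSt_TWACC]
  rw [hS1] at hl
  have rOUT : B0 (q .OUT) = T (q .OUT) := fSt_OUT q T _
  have rTWOUT : B0 (q .TWOUT) = T (q .TWOUT) := fSt_TWOUT q T _
  have rOACC : B0 (q .OACC) = [] := fSt_OACC q T _
  have rTWACC : B0 (q .TWACC) = [] := fSt_TWACC q T _
  have hp1 := runs_opour (a := q .OACC) (b := q .OUT) (hq (by decide))
    (Function.update (Function.update B0 (q .OACC) (outRev (out.map encVec))) (q .TWACC) (outRev (tw'.map encodeNat)))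
  have e1 : Function.update (Function.update (Function.update (Function.update B0 (q .OACC) (outRev (out.map encVec))) (q .TWACC)
      (outRev (tw'.map encodeNat))) (q .OACC) []) (q .OUT)
      ((Function.update (Function.update B0 (q .OACC) (outRev (out.map encVec))) (q .TWACC) (outRev (tw'.map encodeNat)) (q .OACC)).reverse ++
        Function.update (Function.update B0 (q .OACC) (outRev (out.map encVec))) (q .TWACC) (outRev (tw'.map encodeNat)) (q .OUT)) =
      Function.update (Function.update B0 (q .TWACC) (outRev (tw'.map encodeNat))) (q .OUT) (encBlocks out ++ T (q .OUT)) := by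
    rw [Function.update_of_ne (hq (by decide)), Function.update_self, Function.update_of_ne (hq (by decide)),
      Function.update_of_ne (hq (by decide)), rOUT, reverse_outRev]
    rw [show encList (out.map encVec) = encBlocks out from rfl]
    congr 1
    funext k
    by_cases h1 : k = q .OACC
    · subst h1; simp [hq, rOACC]
    · by_cases h2 : k = q .TWACC
      · subst h2; simp [hq]
      · simp [h1, h2]
  rw [e1] at hp1
  have hp2 := runs_opour (a := q .TWACC) (b := q .TWOUT) (hq (by decide))
    (Function.update (Function.update B0 (q .TWACC) (outRev (tw'.map encodeNat))) (q .OUT) (encBlocks out ++ T (q .OUT)))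
  have e2 : Function.update (Function.update (Function.update (Function.update B0 (q .TWACC) (outRev (tw'.map encodeNat))) (q .OUT)
      (encBlocks out ++ T (q .OUT))) (q .TWACC) []) (q .TWOUT)
      ((Function.update (Function.update B0 (q .TWACC) (outRev (tw'.map encodeNat))) (q .OUT) (encBlocks out ++ T (q .OUT)) (q .TWACC)).reverse ++
        Function.update (Function.update B0 (q .TWACC) (outRev (tw'.map encodeNat))) (q .OUT) (encBlocks out ++ T (q .OUT)) (q .TWOUT)) =
      Function.update (Function.update B0 (q .OUT) (encBlocks out ++ T (q .OUT))) (q .TWOUT) (encVec tw' ++ T (q .TWOUT)) := by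
    rw [Function.update_of_ne (hq (by decide)), Function.update_self, Function.update_of_ne (hq (by decide)),
      Function.update_of_ne (hq (by decide)), rTWOUT, reverse_outRev_map]
    congr 1
    funext k
    by_cases h1 : k = q .TWACC
    · subst h1; simp [hq, rTWACC]
    · by_cases h2 : k = q .OUT
      · subst h2; simp [hq]
      · simp [h1, h2]
  rw [e2] at hp2
  refine (hl.seq (hp1.seq hp2)).of_eq (by rw [hB0]) ?_
  simp only [List.map_const', List.sum_replicate, smul_eq_mul]
  rw [Function.update_of_ne (hq (by decide)), Function.update_self, Function.update_of_ne (hq (by decide)), Function.update_self]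
  unfold digitizeCost
  have e3 : done.length * t * (2 * (2 * m * (2 * n)) + 2) = 8 * (done.length * t * m * n) + 2 * (done.length * t) := by ring
  rw [e3] at hlo
  nlinarith [hlo, hltw]

/-! ### The base pass: schoolbook products of paired blocks -/

/-- The multiplier roles inside the level roles. [folklore] -/
abbrev rNF : NReg ↪ β := FReg.ιN.trans q

/-- Updating a non-slot multiplier register commutes with `fSt`. [folklore] -/
theorem fSt_update_n (T : Regs β) (z : FSlots) {x : NReg} (hE : x ≠ .v .E) (hL1 : x ≠ .v .L1) (hL2 : x ≠ .v .L2)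
    (hDST : x ≠ .v .DST) (v : List Bool) : fSt q (Function.update T (q (.n x)) v) z = Function.update (fSt q T z) (q (.n x)) v := by
  have hq : ∀ {i j : FReg}, i ≠ j → q i ≠ q j := fun h => q.injective.ne h
  funext y
  by_cases hy : y = q (.n x)
  · subst hy
    rw [Function.update_self]
    simp only [fSt, Function.update_apply]
    simp [hq, hE, hL1, hL2, hDST]
  · rw [Function.update_of_ne hy]
    simp only [fSt, Function.update_apply, hy, if_false]

/-- Reading a non-slot multiplier register through `fSt`. [folklore] -/
theorem fSt_n (T : Regs β) (z : FSlots) {x : NReg} (hE : x ≠ .v .E) (hL1 : x ≠ .v .L1) (hL2 : x ≠ .v .L2) (hDST : x ≠ .v .DST) :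
    fSt q T z (q (.n x)) = T (q (.n x)) := by
  have hq : ∀ {i j : FReg}, i ≠ j → q i ≠ q j := fun h => q.injective.ne h
  simp only [fSt, Function.update_apply]
  simp [hq, hE, hL1, hL2, hDST]

/-- The base body: read the next `f`-block into `FP` and `g`-block into `GP`, multiply
(`negacyclicMul` of `StackNegacyclic.lean`), emit the product, clear `GP`. [folklore] -/
def baseBody : Com (EReg ⊕ β) :=
  readItemTo (Sum.inr (q .IN)) (Sum.inr (q (.n .FP))) (vr (rVF q) .W) (vr (rVF q) .TT) ;;
  (readItemTo (Sum.inr (q .HOLD2)) (Sum.inr (q (.n .GP))) (vr (rVF q) .W) (vr (rVF q) .TT) ;;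
  (negacyclicMul (rNF q) ;; (emit (Sum.inr (q (.n .ACC))) (Sum.inr (q .OACC)) ;; clear (Sum.inr (q (.n .GP))))))

/-- Cost of the base body on blocks of length `L`. [folklore] -/
def baseBodyCost (n L : ℕ) : ℕ := negMulCost n L + 54 * (L * (2 * n)) + 22

/-- The invariant of the base pass over the base file: `NegMulInv` of the multiplier (modulus
`N`, block length `L`, clean scratch) and `FP GP ACC` empty. [folklore] -/
def BaseInv (N L : ℕ) (T : Regs β) : Prop :=
  NegMulInv (rNF q) N L T ∧ T (q (.n .FP)) = [] ∧ T (q (.n .GP)) = [] ∧ T (q (.n .ACC)) = []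

/-- **The base body.** [folklore] -/
theorem runs_baseBody {N n L : ℕ} (hn : (encodeNat N).length + 1 ≤ n) (hLn : (encodeNat L).length + 1 ≤ n) (T : Regs β)
    (hI : BaseInv q N L T) (z : FSlots) {f g : List ℕ} {fs gs : List (List ℕ)}
    (hf : f.length = L ∧ ∀ a ∈ f, a < N) (hg : g.length = L ∧ ∀ a ∈ g, a < N)
    (hzin : z.inp = encBlocks (f :: fs)) (hzh2 : z.hold2 = encBlocks (g :: gs)) (hze : z.e = []) (hzl1 : z.l1 = []) (hzl2 : z.l2 = [])
    (hzd : z.dst = []) :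
    Runs (baseBody q) (base (fSt q T z))
      (base (fSt q T { z with inp := encBlocks fs, hold2 := encBlocks gs, oacc := pushItem (negMul N L f g) z.oacc })) (baseBodyCost n L) := by
  have hq : ∀ {i j : FReg}, i ≠ j → q i ≠ q j := fun h => q.injective.ne h
  obtain ⟨hNI, hFP, hGP, hACC⟩ := hI
  have hW : T (q (.n (.v .W))) = [] := hNI.2.2.2.2.2.2.2.2.1
  have hTT : T (q (.n (.v .TT))) = [] := hNI.2.2.2.2.2.2.2.2.2.1
  have hN : 0 < N ∨ L = 0 := by
    rcases f with _ | ⟨a, _⟩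
    · right; simpa using hf.1.symm
    · left; exact (Nat.zero_le a).trans_lt (hf.2 a (by simp))
  have hlf : (encVec f).length ≤ L * (2 * n) := by have := length_encVec_le_of_lt hf.2 hn; rwa [hf.1] at this
  have hlg : (encVec g).length ≤ L * (2 * n) := by have := length_encVec_le_of_lt hg.2 hn; rwa [hg.1] at this
  have hpv : (negMul N L f g).length = L ∧ ∀ a ∈ negMul N L f g, a < N := by
    refine ⟨length_negMul f hg.1, fun a ha => ?_⟩
    rcases hN with hN | hL
    · exact lt_of_mem_negMul hN f g ha
    · exfalso; subst hL; have := length_negMul (N := N) f hg.1; rw [List.length_eq_zero_iff] at this; rw [this] at ha; simp at ha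
  have hlp : (encVec (negMul N L f g)).length ≤ L * (2 * n) := by have := length_encVec_le_of_lt hpv.2 hn; rwa [hpv.1] at this
  -- the register files along the way (multiplier registers live in the base file)
  let T1 := Function.update T (q (.n .FP)) (encVec f)
  let T2 := Function.update T1 (q (.n .GP)) (encVec g)
  let T3 := Function.update (Function.update T2 (q (.n .FP)) []) (q (.n .ACC)) (encVec (negMul N L f g))
  let T4 := Function.update T3 (q (.n .ACC)) []
  let T5 := Function.update T4 (q (.n .GP)) []
  let z1 : FSlots := { z with inp := encBlocks fs }
  let z2 : FSlots := { z with inp := encBlocks fs, hold2 := encBlocks gs }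
  let z3 : FSlots := { z with inp := encBlocks fs, hold2 := encBlocks gs, oacc := pushItem (negMul N L f g) z.oacc }
  have cFP : ∀ (T' : Regs β) (zz : FSlots) v, Function.update (fSt q T' zz) (q (.n .FP)) v = fSt q (Function.update T' (q (.n .FP)) v) zz :=
    fun T' zz v => (fSt_update_n q T' zz (by decide) (by decide) (by decide) (by decide) v).symm
  have cGP : ∀ (T' : Regs β) (zz : FSlots) v, Function.update (fSt q T' zz) (q (.n .GP)) v = fSt q (Function.update T' (q (.n .GP)) v) zz :=
    fun T' zz v => (fSt_update_n q T' zz (by decide) (by decide) (by decide) (by decide) v).symm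
  have cACC : ∀ (T' : Regs β) (zz : FSlots) v, Function.update (fSt q T' zz) (q (.n .ACC)) v = fSt q (Function.update T' (q (.n .ACC)) v) zz :=
    fun T' zz v => (fSt_update_n q T' zz (by decide) (by decide) (by decide) (by decide) v).symm
  have rdn : ∀ (T' : Regs β) (zz : FSlots) (x : NReg), x ≠ .v .E → x ≠ .v .L1 → x ≠ .v .L2 → x ≠ .v .DST →
      fSt q T' zz (q (.n x)) = T' (q (.n x)) := fun T' zz x h1 h2 h3 h4 => fSt_n q T' zz h1 h2 h3 h4
  have h1 : Runs (readItemTo (Sum.inr (q .IN)) (Sum.inr (q (.n .FP))) (vr (rVF q) .W) (vr (rVF q) .TT)) (base (fSt q T z))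
      (base (fSt q T1 z1)) (11 * (L * (2 * n)) + 9) := by
    refine (runs_readItemTo (by simp [hq]) (by simp [hq]) (by simp [hq]) (by simp [hq]) (by simp [hq]) (encVec f) (encBlocks fs)
      (base (fSt q T z)) (by simp [hzin, encBlocks_cons]) (by simp [fSt_v, hW]) (by simp [fSt_v, hTT])).of_eq ?_ (by omega)
    simp only [nst_inr, update_nst_inr, update_fSt_IN, rdn _ _ .FP (by decide) (by decide) (by decide) (by decide), hFP, List.append_nil, cFP]
    rfl
  have h2 : Runs (readItemTo (Sum.inr (q .HOLD2)) (Sum.inr (q (.n .GP))) (vr (rVF q) .W) (vr (rVF q) .TT)) (base (fSt q T1 z1))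
      (base (fSt q T2 z2)) (11 * (L * (2 * n)) + 9) := by
    refine (runs_readItemTo (by simp [hq]) (by simp [hq]) (by simp [hq]) (by simp [hq]) (by simp [hq]) (encVec g) (encBlocks gs)
      (base (fSt q T1 z1)) (by simp [z1, hzh2, encBlocks_cons]) (by simp [fSt_v, T1, hW]) (by simp [fSt_v, T1, hTT])).of_eq ?_ (by omega)
    simp only [nst_inr, update_nst_inr, update_fSt_HOLD2, rdn _ _ .GP (by decide) (by decide) (by decide) (by decide), cGP]
    simp [T1, T2, hGP, z1, z2]
  have hI2 : NegMulInv (rNF q) N L (fSt q T2 z2) := by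
    have rd2 : ∀ x : VReg, x ≠ .E → x ≠ .L1 → x ≠ .L2 → x ≠ .DST → fSt q T2 z2 (q (.n (.v x))) = T (q (.n (.v x))) := by
      intro x h1 h2 h3 h4; rw [fSt_v q T2 z2 h1 h2 h3 h4]; simp [T2, T1, hq]
    obtain ⟨hMD, hLEN, hA, hB, hC, hD, hF, hG, hW', hTT', hO, hS, hU, -, -, -⟩ := hNI
    simp only [NegMulInv, rNF, Function.Embedding.trans_apply, FReg.ιN_apply] at hMD hLEN hA hB hC hD hF hG hW' hTT' hO hS hU ⊢
    refine ⟨by rwa [rd2 _ (by decide) (by decide) (by decide) (by decide)], by rwa [rd2 _ (by decide) (by decide) (by decide) (by decide)],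
      by rwa [rd2 _ (by decide) (by decide) (by decide) (by decide)], by rwa [rd2 _ (by decide) (by decide) (by decide) (by decide)],
      by rwa [rd2 _ (by decide) (by decide) (by decide) (by decide)], by rwa [rd2 _ (by decide) (by decide) (by decide) (by decide)],
      by rwa [rd2 _ (by decide) (by decide) (by decide) (by decide)], by rwa [rd2 _ (by decide) (by decide) (by decide) (by decide)],
      by rwa [rd2 _ (by decide) (by decide) (by decide) (by decide)], by rwa [rd2 _ (by decide) (by decide) (by decide) (by decide)],
      by rwa [rd2 _ (by decide) (by decide) (by decide) (by decide)], by rwa [rd2 _ (by decide) (by decide) (by decide) (by decide)],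
      by rwa [rd2 _ (by decide) (by decide) (by decide) (by decide)], by simp [z2, hzl1], by simp [z2, hzl2], by simp [z2, hzd]⟩
  have h3 : Runs (negacyclicMul (rNF q)) (base (fSt q T2 z2)) (base (fSt q T3 z2)) (negMulCost n L) := by
    refine (runs_negacyclicMul (rNF q) hn hLn (fSt q T2 z2) hI2 (by simp [rNF, rdn, T2, T1]) (by simp [rNF, rdn, T2, T1])
      (by simp [rNF, rdn, T2, T1, hACC]) (by simp [rNF, z2, hze]) hf.2 hf.1.le hg.2 hg.1).of_eq ?_ le_rfl
    simp only [rNF, Function.Embedding.trans_apply, FReg.ιN_apply, cFP, cACC]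
    rfl
  have h4 : Runs (emit (Sum.inr (q (.n .ACC))) (Sum.inr (q .OACC))) (base (fSt q T3 z2)) (base (fSt q T4 z3)) (4 * (L * (2 * n)) + 3) := by
    refine (runs_emit (h := Sum.inr (q (.n .ACC))) (o := Sum.inr (q .OACC)) (by simp [hq]) _).of_eq ?_ ?_
    · simp only [nst_inr, update_nst_inr, rdn _ _ .ACC (by decide) (by decide) (by decide) (by decide), cACC, fSt_OACC, update_fSt_OACC]
      simp [T3, T4, z2, z3, pushItem, dbl]
    · simp only [nst_inr, rdn _ _ .ACC (by decide) (by decide) (by decide) (by decide)]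
      simp [T3]; omega
  have h5 : Runs (clear (Sum.inr (q (.n .GP)))) (base (fSt q T4 z3)) (base (fSt q T5 z3)) (2 * (L * (2 * n)) + 1) := by
    refine (runs_clear (Sum.inr (q (.n .GP))) (base (fSt q T4 z3))).of_eq ?_ ?_
    · simp only [update_nst_inr, cGP]; rfl
    · change 2 * (fSt q T4 z3 (q (.n .GP))).length + 1 ≤ _
      rw [rdn _ _ .GP (by decide) (by decide) (by decide) (by decide)]
      simp [T4, T3, T2, hq]; omega
  have hT5 : T5 = T := by
    funext k
    by_cases k1 : k = q (.n .GP)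
    · subst k1; simp [T5, hGP]
    by_cases k2 : k = q (.n .ACC)
    · subst k2; simp [T5, T4, k1, hACC]
    by_cases k3 : k = q (.n .FP)
    · subst k3; simp [T5, T4, T3, k1, k2, hFP]
    simp [T5, T4, T3, T2, T1, k1, k2, k3]
  refine (h1.seq (h2.seq (h3.seq (h4.seq h5)))).of_eq (by rw [hT5]) ?_
  unfold baseBodyCost; omega

/-- The base pass: the zip of `IN` and `HOLD2` under the base body, then the products are poured
forward onto `OUT`. [folklore] -/
def basePass : Com (EReg ⊕ β) :=
  streamLoop (Sum.inr (q .IN)) (vr (rVF q) .W) (baseBody q) ;; pour (Sum.inr (q .OACC)) (Sum.inr (q .OUT))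

/-- Cost of the base pass over `B` pairs of blocks of length `L`. [folklore] -/
def basePassCost (n L B : ℕ) : ℕ := B * (baseBodyCost n L + 6 * (L * (2 * n)) + 12) + 5

/-- `zipWith` then append of one more pair. [folklore] -/
theorem zipWith_append_singleton {α' β' γ : Type*} (f : α' → β' → γ) :
    ∀ (as : List α') (bs : List β') (a : α') (b : β'), as.length = bs.length →
      List.zipWith f (as ++ [a]) (bs ++ [b]) = List.zipWith f as bs ++ [f a b]
  | [], [], _, _, _ => rfl
  | [], _ :: _, _, _, h => by simp at h
  | _ :: _, [], _, _, h => by simp at h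
  | x :: as, y :: bs, a, b, h => by
    rw [List.cons_append, List.cons_append, List.zipWith_cons_cons, List.zipWith_cons_cons,
      zipWith_append_singleton f as bs a b (by simpa using h), List.cons_append]

/-- **The base pass.** With `B` valid `f`-blocks in `IN` and `B` valid `g`-blocks in `HOLD2` (length
`L`), the base invariant and clean slots, the pass empties both and puts the codes of the
negacyclic products `negMul N L fᵢ gᵢ` on top of `OUT`. [folklore] -/
theorem runs_basePass {N n L : ℕ} (hn : (encodeNat N).length + 1 ≤ n) (hLn : (encodeNat L).length + 1 ≤ n) (T : Regs β)
    (hI : BaseInv q N L T) {Fb Gb : List (List ℕ)} (hF : ∀ f ∈ Fb, f.length = L ∧ ∀ a ∈ f, a < N)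
    (hG : ∀ g ∈ Gb, g.length = L ∧ ∀ a ∈ g, a < N) (hlen : Fb.length = Gb.length)
    (hold tmp tw twacc t1 cnt x1 x2 sacc : List Bool) :
    Runs (basePass q) (base (fSt q T ⟨encBlocks Fb, hold, encBlocks Gb, tmp, tw, twacc, t1, cnt, x1, x2, [], sacc, [], [], [], []⟩))
      (base (Function.update (fSt q T ⟨[], hold, [], tmp, tw, twacc, t1, cnt, x1, x2, [], sacc, [], [], [], []⟩) (q .OUT)
        (encBlocks (List.zipWith (negMul N L) Fb Gb) ++ T (q .OUT))))
      (basePassCost n L Fb.length) := by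
  have hq : ∀ {i j : FReg}, i ≠ j → q i ≠ q j := fun h => q.injective.ne h
  have hW : T (q (.n (.v .W))) = [] := hI.1.2.2.2.2.2.2.2.2.1
  let zOf : List (List ℕ) → List (List ℕ) → List (List ℕ) → List (List ℕ) → FSlots := fun fd gd l gl =>
    ⟨encBlocks l, hold, encBlocks gl, tmp, tw, twacc, t1, cnt, x1, x2, outRev ((List.zipWith (negMul N L) fd gd).map encVec), sacc, [], [], [], []⟩
  have hloop := runs_streamLoop (L := Sum.inr (q .IN)) (w := vr (rVF q) .W) (by simp [hq]) (body := baseBody q)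
    encBlocks encBlocks_nil (fun a l => encList_cons_ne_nil (encVec a) (l.map encVec))
    (fun l R => ∃ fd gd gl, fd ++ l = Fb ∧ gd ++ gl = Gb ∧ fd.length = gd.length ∧ R = base (fSt q T (zOf fd gd l gl)))
    (fun _ => baseBodyCost n L)
    (by
      rintro f l R ⟨fd, gd, gl, hfl, hgl, hfg, rfl⟩ - -
      obtain ⟨g, gl', rfl⟩ : ∃ g t, gl = g :: t := by
        cases gl with
        | nil =>
          exfalso
          have h1 := congrArg List.length hfl; have h2 := congrArg List.length hgl
          simp only [List.length_append, List.length_cons, List.length_nil] at h1 h2; omega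
        | cons g t => exact ⟨g, t, rfl⟩
      have hfmem : f ∈ Fb := by rw [← hfl]; simp
      have hgmem : g ∈ Gb := by rw [← hgl]; simp
      have hB := runs_baseBody q hn hLn T hI (zOf fd gd (f :: l) (g :: gl')) (fs := l) (gs := gl') (hF f hfmem) (hG g hgmem)
        rfl rfl rfl rfl rfl rfl
      have heq : base (fSt q T { zOf fd gd (f :: l) (g :: gl') with inp := encBlocks l, hold2 := encBlocks gl', oacc := pushItem (negMul N L f g) (zOf fd gd (f :: l) (g :: gl')).oacc }) = base (fSt q T (zOf (fd ++ [f]) (gd ++ [g]) l gl')) := by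
        simp only [zOf, zipWith_append_singleton _ _ _ _ _ hfg, outRev_map_encVec_append, pushItem]
      refine ⟨_, hB.of_eq heq le_rfl, by simp [zOf], ?_, fd ++ [f], gd ++ [g], gl', by rw [List.append_assoc]; exact hfl,
        by rw [List.append_assoc]; exact hgl, by simp [hfg], rfl⟩
      exact (fSt_v q T _ (by decide) (by decide) (by decide) (by decide)).trans hW)
    Fb (base (fSt q T (zOf [] [] Fb Gb))) ⟨[], [], Gb, rfl, rfl, rfl, rfl⟩ (by simp [zOf])
    ((fSt_v q T _ (by decide) (by decide) (by decide) (by decide)).trans hW)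
  obtain ⟨R', hl, -, -, fd, gd, gl, hfd, hgd, hfg, rfl⟩ := hloop
  rw [List.append_nil] at hfd
  subst hfd
  obtain rfl : gl = [] := by
    have h2 := congrArg List.length hgd
    rw [List.length_append, ← hlen, hfg] at h2
    exact List.eq_nil_of_length_eq_zero (by omega)
  rw [List.append_nil] at hgd
  subst hgd
  have hstart : zOf [] [] fd gd = ⟨encBlocks fd, hold, encBlocks gd, tmp, tw, twacc, t1, cnt, x1, x2, [], sacc, [], [], [], []⟩ := by
    simp only [zOf, List.zipWith_nil_left, List.map_nil, outRev_nil]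
  rw [hstart] at hl
  set out := List.zipWith (negMul N L) fd gd with hout
  have hend : zOf fd gd [] [] = ⟨[], hold, [], tmp, tw, twacc, t1, cnt, x1, x2, outRev (out.map encVec), sacc, [], [], [], []⟩ := by
    simp only [zOf, encBlocks_nil, hout]
  rw [hend] at hl
  have hN : ∀ f ∈ fd, 0 < N ∨ L = 0 := fun f hf => by
    rcases f with _ | ⟨a, _⟩
    · right; simpa using (hF _ hf).1.symm
    · left; exact (Nat.zero_le a).trans_lt ((hF _ hf).2 a (by simp))
  have hov : ∀ c ∈ out, c.length = 2 * (L / 2) + L % 2 ∧ ∀ a ∈ c, a < N := by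
    intro c hc
    obtain ⟨f, hf, g, hg, rfl⟩ := exists_mem_of_mem_zipWith hc
    refine ⟨by rw [length_negMul f (hG g hg).1]; omega, fun a ha => ?_⟩
    rcases hN f hf with hN | hL
    · exact lt_of_mem_negMul hN f g ha
    · exfalso; subst hL; have := length_negMul (N := N) f (hG g hg).1; rw [List.length_eq_zero_iff] at this; rw [this] at ha; simp at ha
  have hlout : out.length = fd.length := by rw [hout, List.length_zipWith, hfg, min_self]
  have hlo : (outRev (out.map encVec)).length ≤ fd.length * (2 * (L * (2 * n)) + 2) := by
    rw [← reverse_encBlocks, List.length_reverse]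
    unfold encBlocks
    rw [length_encList, List.map_map]
    have : ∀ x ∈ out.map ((fun a : List Bool => 2 * a.length + 2) ∘ encVec), x ≤ 2 * (L * (2 * n)) + 2 := by
      intro x hx; rw [List.mem_map] at hx; obtain ⟨u, hu, rfl⟩ := hx
      have h1 := length_encVec_le_of_lt (hov u hu).2 hn
      have h2 : u.length = L := by rw [(hov u hu).1]; omega
      rw [h2] at h1; simp only [Function.comp_apply]; omega
    have hs := List.sum_le_card_nsmul _ _ this
    rwa [List.length_map, hlout, smul_eq_mul] at hs
  have hp := runs_opour (a := q .OACC) (b := q .OUT) (hq (by decide))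
    (fSt q T ⟨[], hold, [], tmp, tw, twacc, t1, cnt, x1, x2, outRev (out.map encVec), sacc, [], [], [], []⟩)
  refine (hl.seq hp).of_eq ?_ ?_
  · simp only [fSt_OACC, fSt_OUT, update_fSt_OACC, reverse_outRev]
    rfl
  · simp only [List.map_const', List.sum_replicate, smul_eq_mul, fSt_OACC]
    unfold basePassCost
    have e3 : fd.length * (2 * (L * (2 * n)) + 2) = 2 * (fd.length * (L * (2 * n))) + 2 * fd.length := by ring
    rw [e3] at hlo
    nlinarith [hlo]

/-! ### Item reversal of a batch -/

/-- The item-reverse body: the next block of `IN` is prepended, as a forward item, to `HOLD`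
(emitted reversed onto `SACC`, then poured). [folklore] -/
def revBody : Com (EReg ⊕ β) :=
  readItemTo (Sum.inr (q .IN)) (Sum.inr (q .TMP)) (vr (rVF q) .W) (vr (rVF q) .TT) ;;
  (emit (Sum.inr (q .TMP)) (Sum.inr (q .SACC)) ;; pour (Sum.inr (q .SACC)) (Sum.inr (q .HOLD)))

/-- The item-reverse pass. [folklore] -/
def revPass : Com (EReg ⊕ β) := streamLoop (Sum.inr (q .IN)) (vr (rVF q) .W) (revBody q)

/-- Cost of the item-reverse pass over `B` blocks of length `L`. [folklore] -/
def revPassCost (n L B : ℕ) : ℕ := B * (21 * (L * (2 * n)) + 25) + 4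

/-- **The item-reverse pass.** `IN = encBlocks Bs` (valid blocks of length `L`), `TMP`, `SACC` empty:
`IN` is emptied and `encBlocks Bs.reverse` is put on top of `HOLD`. [folklore] -/
theorem runs_revPass {N n L : ℕ} (hn : (encodeNat N).length + 1 ≤ n) (T : Regs β) (hW : T (q (.n (.v .W))) = [])
    (hTT : T (q (.n (.v .TT))) = []) {Bs : List (List ℕ)} (hBs : ∀ b ∈ Bs, b.length = L ∧ ∀ a ∈ b, a < N)
    (hold hold2 tw twacc t1 cnt x1 x2 oacc e l1 l2 dst : List Bool) :
    Runs (revPass q) (base (fSt q T ⟨encBlocks Bs, hold, hold2, [], tw, twacc, t1, cnt, x1, x2, oacc, [], e, l1, l2, dst⟩))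
      (base (fSt q T ⟨[], encBlocks Bs.reverse ++ hold, hold2, [], tw, twacc, t1, cnt, x1, x2, oacc, [], e, l1, l2, dst⟩))
      (revPassCost n L Bs.length) := by
  have hq : ∀ {i j : FReg}, i ≠ j → q i ≠ q j := fun h => q.injective.ne h
  have rdW : ∀ zz : FSlots, fSt q T zz (q (.n (.v .W))) = [] := fun zz => by rw [fSt_v q T zz] <;> first | decide | exact hW
  have rdTT : ∀ zz : FSlots, fSt q T zz (q (.n (.v .TT))) = [] := fun zz => by rw [fSt_v q T zz] <;> first | decide | exact hTT
  let zOf : List (List ℕ) → List (List ℕ) → FSlots := fun done l =>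
    ⟨encBlocks l, encBlocks done.reverse ++ hold, hold2, [], tw, twacc, t1, cnt, x1, x2, oacc, [], e, l1, l2, dst⟩
  have hloop := runs_streamLoop (L := Sum.inr (q .IN)) (w := vr (rVF q) .W) (by simp [hq]) (body := revBody q)
    encBlocks encBlocks_nil (fun a l => encList_cons_ne_nil (encVec a) (l.map encVec))
    (fun l R => ∃ done, done ++ l = Bs ∧ R = base (fSt q T (zOf done l))) (fun _ => 21 * (L * (2 * n)) + 19)
    (by
      rintro b l R ⟨done, hdl, rfl⟩ - -
      have hbmem : b ∈ Bs := by rw [← hdl]; simp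
      have hlb : (encVec b).length ≤ L * (2 * n) := by
        have := length_encVec_le_of_lt (hBs b hbmem).2 hn; rwa [(hBs b hbmem).1] at this
      let z1 : FSlots := { zOf done (b :: l) with inp := encBlocks l, tmp := encVec b }
      let z2 : FSlots := { zOf done (b :: l) with inp := encBlocks l, tmp := [], sacc := (dbl (encVec b) ++ [false, true]).reverse }
      have h1 : Runs (readItemTo (Sum.inr (q .IN)) (Sum.inr (q .TMP)) (vr (rVF q) .W) (vr (rVF q) .TT)) (base (fSt q T (zOf done (b :: l))))
          (base (fSt q T z1)) (11 * (L * (2 * n)) + 9) := by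
        refine (runs_readItemTo (by simp [hq]) (by simp [hq]) (by simp [hq]) (by simp [hq]) (by simp [hq]) (encVec b) (encBlocks l)
          (base (fSt q T (zOf done (b :: l)))) (by simp [zOf, encBlocks_cons]) (by simp [rdW]) (by simp [rdTT])).of_eq (by simp [zOf, z1]) ?_
        omega
      have h2 : Runs (emit (Sum.inr (q .TMP)) (Sum.inr (q .SACC))) (base (fSt q T z1)) (base (fSt q T z2)) (4 * (L * (2 * n)) + 3) := by
        refine (runs_emit (h := Sum.inr (q .TMP)) (o := Sum.inr (q .SACC)) (by simp [hq]) _).of_eq ?_ ?_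
        · simp [z1, z2, zOf, dbl, List.reverse_append]
        · simp only [nst_inr, fSt_TMP, z1]; omega
      have h3 : Runs (pour (Sum.inr (q .SACC)) (Sum.inr (q .HOLD))) (base (fSt q T z2)) (base (fSt q T (zOf (done ++ [b]) l)))
          (3 * (2 * (L * (2 * n)) + 2) + 1) := by
        refine (runs_opour (a := q .SACC) (b := q .HOLD) (hq (by decide)) (fSt q T z2)).of_eq ?_ ?_
        · simp [z2, zOf, List.reverse_append, encBlocks_cons]
        · simp only [fSt_SACC, z2, List.length_reverse, List.length_append, length_dbl, List.length_cons, List.length_nil]; omega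
      refine ⟨_, (h1.seq (h2.seq h3)).of_eq rfl (by omega), by simp [zOf], by simp [rdW], done ++ [b], by rw [List.append_assoc]; exact hdl, rfl⟩)
    Bs (base (fSt q T (zOf [] Bs))) ⟨[], rfl, rfl⟩ (by simp [zOf]) (by simp [rdW])
  obtain ⟨R', hl, -, -, done, hdone, rfl⟩ := hloop
  rw [List.append_nil] at hdone
  subst hdone
  refine hl.of_eq (by simp [zOf]) ?_
  simp only [List.map_const', List.sum_replicate, smul_eq_mul]
  unfold revPassCost; nlinarith

end Com

end Literature.Computability.Complexity
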